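import Summits.QuantumFields.YangMills.Theorems.LangevinControlUVOSLegsFromFemtoAndGapStubAssemblyRPObservable
import Summits.QuantumFields.GaugeBoot.ClassBLimitSiteRP
import Literature.MathematicalPhysics.QuantumFieldTheory.ActionDensityTimeReflection
import HarnessLib

/-!
# Infinite-volume reflection positivity, I: the RP square of smeared plane-string fields of a `ℤ⁴` state

R136 (i) «infinite-volume ∕ continuum-from-UV» programme (director-ym), prover seat `ym-infvol-p3`, pre-birth
support filed `--supports` the spine leg `UV` (stmt-QuantumFields-19351) of `route-QuantumFields-BalabanLadder`.
HONEST FRAMING: conditional material for the EXISTENCE half (OS0–OS3 of a continuum limit); nothing here is a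
mass gap, nothing is Clay; NOTHING is asserted about Yang–Mills — every statement is about an arbitrary
probability measure `μ` on the gauge configurations `LGConfig 4 G = (ZdEdge 4 → G)` of the infinite lattice `ℤ⁴`
that is reflection positive for the SITE mirror `x₀ = 0` in the sense of the tree
(`Summit.QuantumFields.GaugeBoot.IsReflectionPositiveFor (configSiteReflect 0) (siteHalfEdges 0) μ`), which the
tree PROVES for every infinite-volume limit point of torus Wilson states at `β ≥ 0`
(`Summit.QuantumFields.GaugeBoot.siteRP_zero_of_mem_infiniteVolumeLimitPoints`).

This is the `ℤ⁴` (infinite-volume state) twin of the spine's torus toolkit XVII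
(`Theorems/LangevinControlUVOSLegsFromFemtoAndGapStubAssemblyRPObservable.lean`), with two differences that make
lattice E2 EXACT: the mirror is the site mirror `x₀ ↦ −x₀` (GaugeBoot's `configSiteReflect 0`, which is the
Literature reflection `cfgReflect`, `configSiteReflect_zero_eq_cfgReflect`), and the smearing points carry an
orientation-dependent OFFSET `o q ∈ ℝ⁴` (plaquette centres `o q = (e_{q.1} + e_{q.2})/2` are the case of
interest; base points `o = 0` are the tree's `smearedLatticeField` convention).

* `reflSite q x = θ₀ x − [q.1 = 0] e₀` — the base site of the reflected plaquette of orientation `q`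
  (temporal plaquettes hang down), an involution; `plane_cfgReflect`: the EXACT reflection law
  `plane q x (Θ U) = plane q (reflSite q x) U` of the tree's single-plane fields
  (`DlrCollarTransfer.plane`, from the Literature corner laws `plaquetteObs_zero_cfgReflect_of_ne`,
  `plaquetteObs_zero_zero_cfgReflect` and `cfgReflect_configShift`);
* `smul_reflSite_add`: in physical units `a (reflSite q x + o q) = ϑ (a (x + o q)) + a (2 (o q)₀ − [q.1 = 0]) e₀`
  (`ϑ = timeReflection 4`): for plaquette-centre offsets the shift VANISHES for all six orientations;
* `strObs` — the centred plane-string observable `∏ₗ (plane (q l) (y l) − m l)` on `ℤ⁴`, its reflection law,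
  continuity, bound, and support in the closed half `siteHalfEdges 0 = {links based at x₀ ≥ 0}` when every
  site has `0 ≤ y_l⁰`;
* `fieldObs a B o F m` — the smeared field `Σ_{q valid} Σ_{y ∈ (box 4 B)ⁿ} F(a (y + o∘q)) ∏ₗ(plane − m)` of a
  test function vanishing whenever some argument has time `≤ 0`, with offsets of time component in `[0, 1)`;
  **`rpSquare_fieldObs_nonneg`**: `0 ≤ Re ∫ conj X(ΘU) X(U) dμ`, `Im = 0` for `X = Σⱼ fieldObs a B o Fⱼ m` —
  the lattice input of E2 in infinite volume; `rpSquare_fieldObs_nonneg_of_mem_infiniteVolumeLimitPoints` reads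
  the RP hypothesis off the GaugeBoot theorem for torus limit points.

References: K. Osterwalder, E. Seiler, Ann. Phys. 110 (1978) 440, §2; E. Seiler, LNP 159 (1982) Ch. 2;
J. Glimm, A. Jaffe, Quantum Physics (1987) §6.1.
-/

noncomputable section

open scoped SchwartzMap BigOperators ComplexConjugate ComplexOrder
open MeasureTheory Filter Topology
open Literature.MathematicalPhysics.QuantumFieldTheory Literature.MathematicalPhysics.QuantumLattice
open Literature.Probability.LatticeModels (box Site mem_box)
open Summit.QuantumFields.YangMills.Cruxes.OSLegsFromFemtoAndGap.DlrCollarTransfer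
  (plane continuous_plane exists_abs_plane_le isCylinder_plane near_of_mem_supp_plane)
open Summit.QuantumFields.GaugeBoot (configSiteReflect zdSiteReflect siteHalfEdges IsReflectionPositiveFor
  siteRP_zero_of_mem_infiniteVolumeLimitPoints)
open Summit.QuantumFields.YangMills.Theorems.OSLegsFromFemtoAndGap (dependsOn_finset_sum' mem_planeStrings_iff'')

namespace Summit.QuantumFields.YangMills.Theorems.InfVolRP

local notation "E4" => EuclideanSpace ℝ (Fin 4)

variable {G : Type} [Group G] [TopologicalSpace G] [IsTopologicalGroup G] [CompactSpace G]
  [MeasurableSpace G] [BorelSpace G]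

/-! ### GaugeBoot's axis-`0` site reflection is the Literature reflection `cfgReflect` -/

omit [TopologicalSpace G] [IsTopologicalGroup G] [CompactSpace G] [MeasurableSpace G] [BorelSpace G] in
/-- On `ℤ⁴`, GaugeBoot's axis-`0` site reflection of gauge configurations is the Literature reflection
`cfgReflect` (`x₀ ↦ −x₀`, temporal links reversed). -/
theorem configSiteReflect_zero_eq_cfgReflect (U : LGConfig 4 G) :
    configSiteReflect (0 : Fin 4) U = cfgReflect U := by
  funext e
  have hθ : zdSiteReflect (0 : Fin 4) e.1 = siteReflect e.1 := rfl
  by_cases he : e.2 = 0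
  · simp only [configSiteReflect, cfgReflect, reflectEdge, he, ↓reduceIte, hθ]
  · simp only [configSiteReflect, cfgReflect, reflectEdge, he, ↓reduceIte, hθ]

/-! ### Reflected sites and the exact reflection law of the plane fields -/

/-- **The base site of the reflected plaquette** of orientation `q`: `reflSite q x = θ₀ x − [q.1 = 0] e₀`
(a temporal plaquette based at `x` is reflected onto the temporal plaquette based one step BELOW `θ₀ x`). -/
def reflSite (q : Fin 4 × Fin 4) (x : Site 4) : Site 4 :=
  siteReflect x - if q.1 = 0 then Pi.single 0 1 else 0

/-- Time coordinate of the reflected site. -/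
theorem reflSite_apply_zero (q : Fin 4 × Fin 4) (x : Site 4) :
    reflSite q x 0 = -x 0 - if q.1 = 0 then 1 else 0 := by
  unfold reflSite
  split_ifs <;> simp

/-- Spatial coordinates of the reflected site. -/
theorem reflSite_apply_of_ne (q : Fin 4 × Fin 4) (x : Site 4) {k : Fin 4} (hk : k ≠ 0) :
    reflSite q x k = x k := by
  unfold reflSite
  split_ifs <;> simp [siteReflect_apply_of_ne x hk, hk]

/-- `reflSite q` is an involution. -/
@[simp] theorem reflSite_reflSite (q : Fin 4 × Fin 4) (x : Site 4) : reflSite q (reflSite q x) = x := by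
  ext k
  by_cases hk : k = 0
  · subst hk; rw [reflSite_apply_zero, reflSite_apply_zero]; ring
  · rw [reflSite_apply_of_ne q _ hk, reflSite_apply_of_ne q _ hk]

/-- `reflSite q` is injective. -/
theorem reflSite_injective (q : Fin 4 × Fin 4) : Function.Injective (reflSite q) :=
  Function.LeftInverse.injective (reflSite_reflSite q)

omit [BorelSpace G] in
/-- **Exact reflection law of the plane fields** under the site mirror: `plane q x (Θ U) = plane q (reflSite q x) U`
(`q.1 < q.2`; magnetic plaquettes are carried along, electric ones hang down one unit — Literature
`plaquetteObs_zero_cfgReflect_of_ne`, `plaquetteObs_zero_zero_cfgReflect`). -/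
theorem plane_cfgReflect (r : LatticeRep G) {q : Fin 4 × Fin 4} (hq : q.1 < q.2) (x : Site 4) (U : LGConfig 4 G) :
    plane G r q x (cfgReflect U) = plane G r q (reflSite q x) U := by
  have hj : q.2 ≠ 0 := fun h => by rw [h] at hq; exact (Fin.not_lt_zero _) hq
  -- move the translation through the reflection
  have hshift : configShift (-x) (cfgReflect U) = cfgReflect (configShift (-siteReflect x) U) := by
    rw [cfgReflect_configShift, siteReflect_neg, siteReflect_siteReflect]
  unfold plane
  rw [hshift]
  by_cases h0 : q.1 = 0
  · -- electric plaquette: one step down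
    have hq2 : plaquetteObs r.ρ 0 q.1 q.2 (cfgReflect (configShift (-siteReflect x) U)) =
        plaquetteObs r.ρ 0 q.1 q.2 (configShift (Pi.single 0 1) (configShift (-siteReflect x) U)) := by
      rw [h0]; exact plaquetteObs_zero_zero_cfgReflect r.ρ r.continuous hj _
    have hcomp : configShift (Pi.single 0 1) (configShift (-siteReflect x) U) =
        configShift (-(siteReflect x - Pi.single 0 1)) U := by
      funext e
      simp only [configShift_apply]
      congr 2
      abel
    rw [hq2, hcomp]
    unfold reflSite
    rw [if_pos h0]
  · -- magnetic plaquette: carried along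
    rw [plaquetteObs_zero_cfgReflect_of_ne r.ρ h0 hj]
    unfold reflSite
    rw [if_neg h0, sub_zero]

/-- **Reflected sites in physical units, with offsets**:
`a (reflSite q x + o) = ϑ (a (x + o)) + a (2 o₀ − [q.1 = 0]) e₀`.
For plaquette-CENTRE offsets (`o₀ = [q.1 = 0]/2`) the shift vanishes: the site mirror acts on centre-smeared plane
fields EXACTLY as the continuum time reflection `ϑ = timeReflection 4`. -/
theorem smul_reflSite_add (a : ℝ) (q : Fin 4 × Fin 4) (x : Site 4) (o : E4) :
    a • (siteToE (reflSite q x) + o) =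
      timeReflection 4 (a • (siteToE x + o)) +
        (a * (2 * o 0 - if q.1 = 0 then 1 else 0)) • EuclideanSpace.single (0 : Fin 4) (1 : ℝ) := by
  ext i
  by_cases hi : i = 0
  · subst hi
    simp only [PiLp.add_apply, PiLp.smul_apply, smul_eq_mul, siteToE_apply, reflSite_apply_zero,
      timeReflection_apply, ↓reduceIte, EuclideanSpace.single, PiLp.single_eq_same]
    split_ifs <;> push_cast <;> ring
  · simp only [PiLp.add_apply, PiLp.smul_apply, smul_eq_mul, siteToE_apply, reflSite_apply_of_ne q x hi,
      timeReflection_apply, hi, ↓reduceIte, EuclideanSpace.single, PiLp.single_eq_of_ne (p := 2) hi, mul_zero,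
      add_zero]

/-- The centre-offset case: no shift. -/
theorem smul_reflSite_add_of_centre (a : ℝ) (q : Fin 4 × Fin 4) (x : Site 4) (o : E4)
    (ho : 2 * o 0 = if q.1 = 0 then 1 else 0) :
    a • (siteToE (reflSite q x) + o) = timeReflection 4 (a • (siteToE x + o)) := by
  rw [smul_reflSite_add, ho, sub_self, mul_zero, zero_smul, add_zero]

/-! ### The centred plane-string observable on `ℤ⁴` -/

/-- **Centred plane-string observable** of an infinite-volume state: `∏ₗ (plane (q l) (y l) U − m l)`. -/
def strObs (r : LatticeRep G) {n : ℕ} (q : Fin n → Fin 4 × Fin 4) (m : Fin n → ℝ) (y : Fin n → Site 4)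
    (U : LGConfig 4 G) : ℝ :=
  ∏ l, (plane G r (q l) (y l) U - m l)

omit [BorelSpace G] in
/-- **Reflection law of the string observable.** -/
theorem strObs_cfgReflect (r : LatticeRep G) {n : ℕ} {q : Fin n → Fin 4 × Fin 4} (hq : ∀ l, (q l).1 < (q l).2)
    (m : Fin n → ℝ) (y : Fin n → Site 4) (U : LGConfig 4 G) :
    strObs r q m y (cfgReflect U) = strObs r q m (fun l => reflSite (q l) (y l)) U := by
  unfold strObs
  exact Finset.prod_congr rfl fun l _ => by rw [plane_cfgReflect r (hq l)]

omit [IsTopologicalGroup G] [CompactSpace G] [BorelSpace G] in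
/-- **The product of two string observables is the appended string.** -/
theorem strObs_mul_strObs (r : LatticeRep G) {n k : ℕ} (q : Fin n → Fin 4 × Fin 4) (p : Fin k → Fin 4 × Fin 4)
    (m₁ : Fin n → ℝ) (m₂ : Fin k → ℝ) (x : Fin n → Site 4) (y : Fin k → Site 4) (U : LGConfig 4 G) :
    strObs r q m₁ x U * strObs r p m₂ y U =
      strObs r (Fin.append q p) (Fin.append m₁ m₂) (Fin.append x y) U := by
  unfold strObs
  rw [Fin.prod_univ_add]
  simp only [Fin.append_left, Fin.append_right]

omit [CompactSpace G] [BorelSpace G] in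
/-- The string observable is continuous. -/
theorem continuous_strObs (r : LatticeRep G) {n : ℕ} (q : Fin n → Fin 4 × Fin 4) (m : Fin n → ℝ)
    (y : Fin n → Site 4) : Continuous (strObs r q m y) := by
  unfold strObs
  exact continuous_finsetProd _ fun l _ => (continuous_plane r (q l) (y l)).sub continuous_const

omit [CompactSpace G] in
/-- The string observable is measurable (`G` second countable, so that the product σ-algebra is Borel). -/
theorem measurable_strObs [SecondCountableTopology G] (r : LatticeRep G) {n : ℕ} (q : Fin n → Fin 4 × Fin 4)
    (m : Fin n → ℝ) (y : Fin n → Site 4) : Measurable (strObs r q m y) :=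
  (continuous_strObs r q m y).measurable

omit [IsTopologicalGroup G] [CompactSpace G] [BorelSpace G] in
/-- The string observable is bounded: `|strObs| ≤ (Cₚ + Cₘ)ⁿ` if `|plane| ≤ Cₚ`, `|m l| ≤ Cₘ`. -/
theorem abs_strObs_le (r : LatticeRep G) {n : ℕ} (q : Fin n → Fin 4 × Fin 4) {m : Fin n → ℝ} {Cp Cm : ℝ}
    (hCp : ∀ (q : Fin 4 × Fin 4) (x : Fin 4 → ℤ) (U : LGConfig 4 G), |plane G r q x U| ≤ Cp)
    (hCm : ∀ l, |m l| ≤ Cm) (y : Fin n → Site 4) (U : LGConfig 4 G) :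
    |strObs r q m y U| ≤ (Cp + Cm) ^ n := by
  unfold strObs
  rw [Finset.abs_prod]
  calc _ ≤ ∏ _l : Fin n, (Cp + Cm) := Finset.prod_le_prod (fun _ _ => abs_nonneg _) fun l _ =>
        (abs_sub _ _).trans (add_le_add (hCp _ _ _) (hCm l))
    _ = (Cp + Cm) ^ n := by simp

omit [IsTopologicalGroup G] [CompactSpace G] [BorelSpace G] in
/-- **Support of a plane field**: the plane field at a site of time `≥ 0` depends only on links of the closed
half `siteHalfEdges 0` (its four links are based at `y`, `y + e_{q.1}`, `y + e_{q.2}`). -/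
theorem dependsOn_plane (r : LatticeRep G) (q : Fin 4 × Fin 4) {y : Site 4} (hy : 0 ≤ y 0) :
    DependsOn (plane G r q y) (siteHalfEdges (d := 4) 0) := by
  intro U V hUV
  refine isCylinder_plane r q y fun e he => hUV e ?_
  have h := (near_of_mem_supp_plane he 0).1
  show 0 ≤ e.1 0
  omega

omit [IsTopologicalGroup G] [CompactSpace G] [BorelSpace G] in
/-- **Support of the string observable**: if every site has `0 ≤ y_l⁰`, `strObs` depends only on the links of
the closed positive half `siteHalfEdges 0`. -/
theorem dependsOn_strObs (r : LatticeRep G) {n : ℕ} (q : Fin n → Fin 4 × Fin 4) (m : Fin n → ℝ)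
    {y : Fin n → Site 4} (hy : ∀ l, 0 ≤ y l 0) : DependsOn (strObs r q m y) (siteHalfEdges (d := 4) 0) := by
  intro U V hUV
  unfold strObs
  exact Finset.prod_congr rfl fun l _ => by rw [dependsOn_plane r (q l) (hy l) hUV]

/-! ### The smeared field and the reflection-positivity square -/

/-- **Smeared plane-string field** of a test function in an infinite-volume state, at spacing `a`, summation box
`box 4 B`, orientation offsets `o` and centrings `m`:
`Σ_{q valid} Σ_{y ∈ (box 4 B)ⁿ} F(a (y l + o (q l)))_l · ∏ₗ (plane (q l) (y l) − m (q l))`. -/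
def fieldObs (r : LatticeRep G) (a : ℝ) (B : ℕ) (o : Fin 4 × Fin 4 → E4) {n : ℕ} (F : 𝓢((Fin n → E4), ℂ))
    (m : Fin 4 × Fin 4 → ℝ) (U : LGConfig 4 G) : ℂ :=
  ∑ q ∈ Fintype.piFinset (fun _ : Fin n => Finset.univ.filter fun p : Fin 4 × Fin 4 => p.1 < p.2),
    ∑ y ∈ Fintype.piFinset (fun _ : Fin n => box 4 B),
    F (fun l => a • (siteToE (y l) + o (q l))) * (strObs r q (fun l => m (q l)) y U : ℂ)

omit [CompactSpace G] [BorelSpace G] in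
/-- The smeared field is continuous. -/
theorem continuous_fieldObs (r : LatticeRep G) (a : ℝ) (B : ℕ) (o : Fin 4 × Fin 4 → E4) {n : ℕ}
    (F : 𝓢((Fin n → E4), ℂ)) (m : Fin 4 × Fin 4 → ℝ) : Continuous (fieldObs r a B o F m) := by
  unfold fieldObs
  refine continuous_finsetSum _ fun q _ => continuous_finsetSum _ fun y _ => ?_
  exact continuous_const.mul (Complex.continuous_ofReal.comp (continuous_strObs r q _ y))

omit [CompactSpace G] in
/-- The smeared field is measurable. -/
theorem measurable_fieldObs [SecondCountableTopology G] (r : LatticeRep G) (a : ℝ) (B : ℕ)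
    (o : Fin 4 × Fin 4 → E4) {n : ℕ} (F : 𝓢((Fin n → E4), ℂ)) (m : Fin 4 × Fin 4 → ℝ) :
    Measurable (fieldObs r a B o F m) :=
  (continuous_fieldObs r a B o F m).measurable

omit [BorelSpace G] in
/-- The smeared field is bounded. -/
theorem exists_norm_fieldObs_le (r : LatticeRep G) (a : ℝ) (B : ℕ) (o : Fin 4 × Fin 4 → E4) {n : ℕ}
    (F : 𝓢((Fin n → E4), ℂ)) (m : Fin 4 × Fin 4 → ℝ) :
    ∃ C : ℝ, ∀ U, ‖fieldObs r a B o F m U‖ ≤ C := by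
  obtain ⟨Cp, hCp⟩ := exists_abs_plane_le (G := G) r
  set Cm : ℝ := ∑ q : Fin 4 × Fin 4, |m q|
  have hCm : ∀ q, |m q| ≤ Cm := fun q =>
    Finset.single_le_sum (f := fun q => |m q|) (fun _ _ => abs_nonneg _) (Finset.mem_univ q)
  obtain ⟨CF, hCF⟩ : ∃ CF, ∀ x, ‖F x‖ ≤ CF := ⟨SchwartzMap.seminorm ℂ 0 0 F, fun x => by
    have := SchwartzMap.le_seminorm ℂ 0 0 F x; rwa [pow_zero, one_mul, norm_iteratedFDeriv_zero] at this⟩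
  refine ⟨∑ _q ∈ Fintype.piFinset (fun _ : Fin n => Finset.univ.filter fun p : Fin 4 × Fin 4 => p.1 < p.2),
    ∑ _y ∈ Fintype.piFinset (fun _ : Fin n => box 4 B), CF * (Cp + Cm) ^ n,
    fun U => ?_⟩
  unfold fieldObs
  refine (norm_sum_le _ _).trans (Finset.sum_le_sum fun q _ => (norm_sum_le _ _).trans
    (Finset.sum_le_sum fun y _ => ?_))
  rw [norm_mul, Complex.norm_real, Real.norm_eq_abs]
  exact mul_le_mul (hCF _) (abs_strObs_le r q hCp (fun l => hCm (q l)) y U) (abs_nonneg _)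
    ((norm_nonneg (F 0)).trans (hCF 0))

/-- **Time localisation on the lattice**: if `F` vanishes as soon as some argument has time `≤ 0`, the offsets
have time components in `[0, 1)` and `a > 0`, then `F (a (y + o∘q)) ≠ 0` forces `0 ≤ y_l⁰` for every `l`. -/
theorem nonneg_of_apply_ne_zero {n : ℕ} {a : ℝ} (ha : 0 < a) {o : Fin 4 × Fin 4 → E4}
    (ho : ∀ q, 0 ≤ o q 0 ∧ o q 0 < 1) (F : 𝓢((Fin n → E4), ℂ))
    (hF : ∀ u : Fin n → E4, (∃ l, u l 0 ≤ 0) → F u = 0) (q : Fin n → Fin 4 × Fin 4) (y : Fin n → Site 4)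
    (h : F (fun l => a • (siteToE (y l) + o (q l))) ≠ 0) : ∀ l, 0 ≤ y l 0 := by
  intro l
  by_contra hlt
  push Not at hlt
  refine h (hF _ ⟨l, ?_⟩)
  have hy : (y l 0 : ℝ) ≤ -1 := by exact_mod_cast (show y l 0 ≤ -1 by omega)
  have h1 : (y l 0 : ℝ) + o (q l) 0 ≤ 0 := by linarith [(ho (q l)).2]
  simp only [PiLp.smul_apply, PiLp.add_apply, siteToE_apply, smul_eq_mul]
  exact mul_nonpos_iff.2 (Or.inl ⟨ha.le, h1⟩)

omit [IsTopologicalGroup G] [CompactSpace G] [BorelSpace G] in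
/-- **Support of the smeared field**: for a test function vanishing whenever some argument has time `≤ 0`,
offsets with time components in `[0, 1)` and `a > 0`, the smeared field depends only on the links of the closed
half `siteHalfEdges 0`. -/
theorem dependsOn_fieldObs (r : LatticeRep G) {a : ℝ} (ha : 0 < a) (B : ℕ) {o : Fin 4 × Fin 4 → E4}
    (ho : ∀ q, 0 ≤ o q 0 ∧ o q 0 < 1) {n : ℕ} (F : 𝓢((Fin n → E4), ℂ))
    (hF : ∀ u : Fin n → E4, (∃ l, u l 0 ≤ 0) → F u = 0) (m : Fin 4 × Fin 4 → ℝ) :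
    DependsOn (fieldObs r a B o F m) (siteHalfEdges (d := 4) 0) := by
  intro U V hUV
  unfold fieldObs
  refine Finset.sum_congr rfl fun q _ => Finset.sum_congr rfl fun y _ => ?_
  by_cases h0 : F (fun l => a • (siteToE (y l) + o (q l))) = 0
  · rw [h0, zero_mul, zero_mul]
  · rw [dependsOn_strObs r q _ (nonneg_of_apply_ne_zero ha ho F hF q y h0) hUV]

/-- **The reflection-positivity square of finitely many smeared fields is non-negative** in every site-RP state
`μ` of the infinite lattice: for test functions vanishing whenever some argument has time `≤ 0` and offsets with
time components in `[0, 1)`, `X = Σⱼ fieldObs a B o Fⱼ m` lives on the closed half `{x₀ ≥ 0}`, so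
`0 ≤ Re ∫ conj X(ΘU) X(U) dμ` and `Im = 0` (`Θ = cfgReflect`). -/
theorem rpSquare_fieldObs_nonneg [SecondCountableTopology G] (r : LatticeRep G) {μ : Measure (LGConfig 4 G)}
    (hμ : IsReflectionPositiveFor (configSiteReflect (G := G) 0) (siteHalfEdges 0) μ)
    {a : ℝ} (ha : 0 < a) (B : ℕ) {o : Fin 4 × Fin 4 → E4} (ho : ∀ q, 0 ≤ o q 0 ∧ o q 0 < 1)
    {N : ℕ} {deg : Fin N → ℕ} (F : (j : Fin N) → 𝓢((Fin (deg j) → E4), ℂ))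
    (hF : ∀ j (u : Fin (deg j) → E4), (∃ l, u l 0 ≤ 0) → F j u = 0) (m : Fin 4 × Fin 4 → ℝ) :
    let z := ∫ U, conj (∑ j, fieldObs r a B o (F j) m (cfgReflect U)) * ∑ j, fieldObs r a B o (F j) m U ∂μ
    0 ≤ z.re ∧ z.im = 0 := by
  have hpos := hμ (fun U => ∑ j, fieldObs r a B o (F j) m U)
    (Finset.measurable_sum _ fun j _ => measurable_fieldObs r a B o (F j) m)
    (by
      choose C hC using fun j => exists_norm_fieldObs_le r a B o (F j) m
      exact ⟨∑ j, C j, fun U => (norm_sum_le _ _).trans (Finset.sum_le_sum fun j _ => hC j U)⟩)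
    (dependsOn_finset_sum' _ fun j _ => dependsOn_fieldObs r ha B ho (F j) (hF j) m)
  simp only [configSiteReflect_zero_eq_cfgReflect] at hpos
  exact ⟨(Complex.nonneg_iff.1 hpos).1, (Complex.nonneg_iff.1 hpos).2.symm⟩

/-- **The same for every infinite-volume limit point of the torus Wilson states at `β ≥ 0`** (the RP hypothesis is
the GaugeBoot theorem `siteRP_zero_of_mem_infiniteVolumeLimitPoints`). -/
theorem rpSquare_fieldObs_nonneg_of_mem_infiniteVolumeLimitPoints [T2Space G] [SecondCountableTopology G]
    (r : LatticeRep G) {β : ℝ} (hβ : 0 ≤ β) {μ : Measure (LGConfig 4 G)}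
    (hμ : μ ∈ infiniteVolumeLimitPoints (d := 4) r.ρ β)
    {a : ℝ} (ha : 0 < a) (B : ℕ) {o : Fin 4 × Fin 4 → E4} (ho : ∀ q, 0 ≤ o q 0 ∧ o q 0 < 1)
    {N : ℕ} {deg : Fin N → ℕ} (F : (j : Fin N) → 𝓢((Fin (deg j) → E4), ℂ))
    (hF : ∀ j (u : Fin (deg j) → E4), (∃ l, u l 0 ≤ 0) → F j u = 0) (m : Fin 4 × Fin 4 → ℝ) :
    let z := ∫ U, conj (∑ j, fieldObs r a B o (F j) m (cfgReflect U)) * ∑ j, fieldObs r a B o (F j) m U ∂μ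
    0 ≤ z.re ∧ z.im = 0 :=
  rpSquare_fieldObs_nonneg r (siteRP_zero_of_mem_infiniteVolumeLimitPoints r.ρ r.continuous hβ hμ) ha B ho F hF m

end Summit.QuantumFields.YangMills.Theorems.InfVolRP

end
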